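import Summits.AtomisticToContinuum.HydrodynamicLimit.Theses.JParityClosure
import Summits.AtomisticToContinuum.HydrodynamicLimit.Theorems.JParityClosureRateFloorLineDefs
import Literature.Analysis.FluidPDE.HardSphereCollisionRecord
import Literature.Analysis.FluidPDE.HardSphereFreeStretch
import Literature.MathematicalPhysics.KineticTheory.HardSphereEuler
import Literature.MathematicalPhysics.KineticTheory.CollisionTubePullbackDefs
import Literature.MathematicalPhysics.KineticTheory.HardSphereUniformGasShift
import Summits.AtomisticToContinuum.HydrodynamicLimit.Theorems.JParityClosureEvenStressEnskogShortFlightDeficitRung0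

/-!
# Crux `JParityClosure.RateFloor` (stmt-AtomisticToContinuum-13080), line `Sketch`: NO BURSTS AT RUNG 0 — file 1/3, glue and geometry

Rung-0 (constant-profile) instance of the registered stub S7a `stub_noBursts` of the line `Sketch`, split over three files
(`…NoBurstsRung0Glue`, `…NoBurstsRung0Statics`, `…NoBurstsRung0`); proof by the wave-1 stub worker of the gen-1 lead, over the
line's reviewed definitions `RateFloorLine.{wouldBePairs, multiPairs, secondaryCount, lineBursts, windowLenB}`
(`Theorems/JParityClosureRateFloorLineDefs.lean`).  THIS FILE (registered helper stub `stub_secondaryLeShortFlight`):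

* GLUE (G1): every secondary contact incidence of a window `(kΔ, (k+1)Δ]` is a collision preceded by a collision of a partner
  within time `Δ`, and the windows are disjoint, so `Σ_k secondaryCount ≤ collisionPairSum 𝟙[s − Δ < pairFlightStart]` — the
  tree's SHORT-FLIGHT COUNT with `ℓ = Δ` (`sum_secondaryCount_le_shortCount`; its rung-0 Gibbs tail is the landed
  `EvenStressEnskog.shortFlightCountRung0_le`);
* GEOMETRY of would-be pairs on `𝕋³`: a would-be pair is at exact contact at some time of `[0, Δ]` along the forward free flight
  (`exists_contact_of_wouldBe`, intermediate value theorem for the minimal-image distance), hence a lattice lift of the relative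
  position lies in the forward swept tube (`exists_latticeVec_mem_of_wouldBe`); symmetry of would-be pairs;
* COMBINATORICS: every multi-pair sits in a would-be TRIPLE (`card_multiPairs_le_sum`);
* ASYMPTOTICS of the window `Δ_N = A(N+1)^{-b}`: `Δ_N → 0`, `Δ_N(N+1)ε_N² = Aσ²(N+1)^{1/3−b} → 0` iff `b > 1/3`, and the algebra
  of the final bound (`rung0_bound_algebra`).

References: C. Cercignani, R. Illner, M. Pulvirenti, *The Mathematical Theory of Dilute Gases* (1994), §2.2, App. 4.A;
I. Gallagher, L. Saint-Raymond, B. Texier, *From Newton to Boltzmann* (2013), Prop. 4.1.1; D. Ruelle, *Statistical Mechanics: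
Rigorous Results* (1969), §4.2.
-/

noncomputable section

open scoped BigOperators Topology ENNReal NNReal Classical
open MeasureTheory Set Filter Function
open Literature.Analysis.FluidPDE Literature.Analysis.FunctionSpaces Literature.MathematicalPhysics.KineticTheory

namespace Summit.AtomisticToContinuum.HydrodynamicLimit.Theorems

namespace RateFloorNoBursts

open RateFloorLine

/-! ### Glue (G1): window-summed secondary incidences ≤ the short-flight count with `ℓ = Δ` -/

/-- One window: on a good orbit, the secondary contact incidences of `(s, s + Δ]` with `0 ≤ s` are at most the
collision pair sum over the collision times of `(s, s + Δ]` of the short-flight indicator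
`𝟙[u − Δ < pairFlightStart(i, j, u)]` — a member of a secondary pair participated at some `u' ∈ (s, u)`, and
`u' ≤ flightStart ≤ pairFlightStart`, while `u − Δ ≤ s < u'`. [folklore] -/
theorem secondaryCount_le_window_sum {σ : ℝ} {N : ℕ}
    (Φ : HardSphereFlow (Torus.geometry (Fin 3)) (hsDiameter σ N) (N + 1))
    {z : Config (N + 1) (Fin 3) T3} (hz : z ∈ Φ.good) {s Δ : ℝ} (hs : 0 ≤ s)
    (hfin : (collisionTimes (Torus.geometry (Fin 3)) (hsDiameter σ N) (orbit σ N Φ z) ∩ Set.Ioc s (s + Δ)).Finite) :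
    (secondaryCount (hsDiameter σ N) (orbit σ N Φ z) s (s + Δ) : ℝ) ≤
      ∑ u ∈ hfin.toFinset, ∑ p ∈ contactPairs (Torus.geometry (Fin 3)) (hsDiameter σ N) (orbit σ N Φ z u),
        (if u - Δ < pairFlightStart σ N Φ z p.1 p.2 u then (1 : ℝ) else 0) := by
  have htraj := Φ.isTrajectory z hz
  unfold secondaryCount
  rw [finsum_mem_eq_finite_toFinset_sum _ hfin, Nat.cast_sum]
  refine Finset.sum_le_sum fun u hu => ?_
  rw [Finset.natCast_card_filter]
  refine Finset.sum_le_sum fun p _ => ?_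
  have hu' : u ∈ Set.Ioc s (s + Δ) := ((Set.Finite.mem_toFinset hfin).1 hu).2
  by_cases hP : ∃ u' ∈ Set.Ioo s u, Participates (Torus.geometry (Fin 3)) (hsDiameter σ N) (orbit σ N Φ z u') p.1 ∨
      Participates (Torus.geometry (Fin 3)) (hsDiameter σ N) (orbit σ N Φ z u') p.2
  · obtain ⟨u', hu'mem, hpart⟩ := hP
    have hlt : u - Δ < pairFlightStart σ N Φ z p.1 p.2 u := by
      have h0u' : 0 < u' := hs.trans_lt hu'mem.1
      have key : ∀ k : Fin (N + 1), Participates (Torus.geometry (Fin 3)) (hsDiameter σ N) (orbit σ N Φ z u') k →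
          u' ≤ flightStart (Torus.geometry (Fin 3)) (hsDiameter σ N) (orbit σ N Φ z) 0 k u := by
        intro k hk
        exact le_flightStart_of_mem (htraj.finite_collisionTimesOf_inter_Ioo k 0 u)
          (mem_collisionTimesOf.2 hk) h0u' hu'mem.2
      have hwin : u - Δ < u' := by linarith [hu'.2, hu'mem.1]
      rcases hpart with h1 | h2
      · exact hwin.trans_le ((key p.1 h1).trans (le_max_left _ _))
      · exact hwin.trans_le ((key p.2 h2).trans (le_max_right _ _))
    rw [if_pos ⟨u', hu'mem, hpart⟩, if_pos hlt]
  · rw [if_neg hP]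
    split_ifs <;> norm_num

/-- **(G1)** On a good orbit, for `Δ > 0` and `τ ≥ 0`, the secondary contact incidences summed over the windows
`(kΔ, (k+1)Δ]`, `k < ⌊τ/Δ⌋`, are at most the SHORT-FLIGHT COUNT of `[0, τ]` with flight window `ℓ = Δ`
(the collision pair sum of `𝟙[s − Δ < pairFlightStart]`, the object bounded in Gibbs probability at rung 0 by
`EvenStressEnskog.shortFlightCountRung0_le`): the windows are disjoint sub-intervals of `[0, τ]` and each
secondary incidence is a short flight (`secondaryCount_le_window_sum`). [folklore] -/
theorem sum_secondaryCount_le_shortCount {σ : ℝ} {N : ℕ}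
    (Φ : HardSphereFlow (Torus.geometry (Fin 3)) (hsDiameter σ N) (N + 1))
    {z : Config (N + 1) (Fin 3) T3} (hz : z ∈ Φ.good) {Δ τ : ℝ} (hΔ : 0 < Δ) (hτ : 0 ≤ τ) :
    (∑ k ∈ Finset.range ⌊τ / Δ⌋₊,
        (secondaryCount (hsDiameter σ N) (orbit σ N Φ z) (k * Δ) (k * Δ + Δ) : ℝ)) ≤
      collisionPairSum (Torus.geometry (Fin 3)) (hsDiameter σ N) (orbit σ N Φ z) (Set.Icc 0 τ)
        (fun s i j => if s - Δ < pairFlightStart σ N Φ z i j s then (1 : ℝ) else 0) := by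
  have htraj : IsHardSphereTrajectory (Torus.geometry (Fin 3)) (hsDiameter σ N) (N + 1) (orbit σ N Φ z) :=
    Φ.isTrajectory z hz
  have hfinτ : (collisionTimes (Torus.geometry (Fin 3)) (hsDiameter σ N) (orbit σ N Φ z) ∩ Set.Icc 0 τ).Finite :=
    htraj.locFinite 0 τ
  -- the window pieces lie in `[0, τ]`
  have hwinsub : ∀ k ∈ Finset.range ⌊τ / Δ⌋₊, Set.Ioc ((k : ℝ) * Δ) (k * Δ + Δ) ⊆ Set.Icc 0 τ := by
    intro k hk u hu
    have hk' : ((k : ℝ) + 1) * Δ ≤ τ := by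
      have h1 : (k : ℝ) + 1 ≤ ⌊τ / Δ⌋₊ := by exact_mod_cast Finset.mem_range.1 hk
      have h2 : ((⌊τ / Δ⌋₊ : ℕ) : ℝ) ≤ τ / Δ := Nat.floor_le (div_nonneg hτ hΔ.le)
      calc ((k : ℝ) + 1) * Δ ≤ (τ / Δ) * Δ := by gcongr; exact h1.trans h2
        _ = τ := by field_simp
    have hk0 : (0 : ℝ) ≤ k * Δ := by positivity
    exact ⟨hk0.trans hu.1.le, by linarith [hu.2]⟩
  have hfink : ∀ k : ℕ, (collisionTimes (Torus.geometry (Fin 3)) (hsDiameter σ N) (orbit σ N Φ z) ∩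
      Set.Ioc ((k : ℝ) * Δ) (k * Δ + Δ)).Finite := fun k =>
    (htraj.locFinite (k * Δ) (k * Δ + Δ)).subset (Set.inter_subset_inter_right _ Set.Ioc_subset_Icc_self)
  -- the summand of the short-flight count at a collision time, nonnegative
  have hf0 : ∀ u, 0 ≤ ∑ p ∈ contactPairs (Torus.geometry (Fin 3)) (hsDiameter σ N) (orbit σ N Φ z u),
      (if u - Δ < pairFlightStart σ N Φ z p.1 p.2 u then (1 : ℝ) else 0) :=
    fun u => Finset.sum_nonneg fun p _ => by split_ifs <;> norm_num
  -- each window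
  have hstep : ∀ k ∈ Finset.range ⌊τ / Δ⌋₊,
      (secondaryCount (hsDiameter σ N) (orbit σ N Φ z) (k * Δ) (k * Δ + Δ) : ℝ) ≤
        ∑ u ∈ (hfink k).toFinset, ∑ p ∈ contactPairs (Torus.geometry (Fin 3)) (hsDiameter σ N) (orbit σ N Φ z u),
          (if u - Δ < pairFlightStart σ N Φ z p.1 p.2 u then (1 : ℝ) else 0) := by
    intro k hk
    have hk0 : (0 : ℝ) ≤ k * Δ := by positivity
    exact secondaryCount_le_window_sum Φ hz hk0 (hfink k)
  -- disjointness of the window pieces and inclusion in `[0, τ]`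
  have hdisj : Set.PairwiseDisjoint (↑(Finset.range ⌊τ / Δ⌋₊) : Set ℕ) fun k => (hfink k).toFinset := by
    intro k _ k' _ hkk'
    rw [Function.onFun, Finset.disjoint_left]
    intro u hu hu'
    have h1 : u ∈ Set.Ioc ((k : ℝ) * Δ) (k * Δ + Δ) := ((Set.Finite.mem_toFinset _).1 hu).2
    have h2 : u ∈ Set.Ioc ((k' : ℝ) * Δ) (k' * Δ + Δ) := ((Set.Finite.mem_toFinset _).1 hu').2
    apply hkk'
    have h3 : (k : ℝ) < k' + 1 := by
      by_contra h
      have h' : (k' : ℝ) + 1 ≤ k := not_lt.1 h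
      have : ((k' : ℝ) + 1) * Δ ≤ k * Δ := by gcongr
      linarith [h1.1, h2.2]
    have h4 : (k' : ℝ) < k + 1 := by
      by_contra h
      have h' : (k : ℝ) + 1 ≤ k' := not_lt.1 h
      have : ((k : ℝ) + 1) * Δ ≤ k' * Δ := by gcongr
      linarith [h2.1, h1.2]
    have h3' : k < k' + 1 := by exact_mod_cast h3
    have h4' : k' < k + 1 := by exact_mod_cast h4
    omega
  have hsub : (Finset.range ⌊τ / Δ⌋₊).biUnion (fun k => (hfink k).toFinset) ⊆ hfinτ.toFinset := by
    intro u hu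
    rw [Finset.mem_biUnion] at hu
    obtain ⟨k, hk, hu⟩ := hu
    have hu' := (Set.Finite.mem_toFinset _).1 hu
    exact (Set.Finite.mem_toFinset _).2 ⟨hu'.1, hwinsub k hk hu'.2⟩
  have e1 : (∑ k ∈ Finset.range ⌊τ / Δ⌋₊, (secondaryCount (hsDiameter σ N) (orbit σ N Φ z) (k * Δ) (k * Δ + Δ) : ℝ))
      ≤ ∑ k ∈ Finset.range ⌊τ / Δ⌋₊, ∑ u ∈ (hfink k).toFinset,
          ∑ p ∈ contactPairs (Torus.geometry (Fin 3)) (hsDiameter σ N) (orbit σ N Φ z u),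
            (if u - Δ < pairFlightStart σ N Φ z p.1 p.2 u then (1 : ℝ) else 0) := Finset.sum_le_sum hstep
  have e2 : (∑ k ∈ Finset.range ⌊τ / Δ⌋₊, ∑ u ∈ (hfink k).toFinset,
          ∑ p ∈ contactPairs (Torus.geometry (Fin 3)) (hsDiameter σ N) (orbit σ N Φ z u),
            (if u - Δ < pairFlightStart σ N Φ z p.1 p.2 u then (1 : ℝ) else 0))
        = ∑ u ∈ (Finset.range ⌊τ / Δ⌋₊).biUnion (fun k => (hfink k).toFinset),
          ∑ p ∈ contactPairs (Torus.geometry (Fin 3)) (hsDiameter σ N) (orbit σ N Φ z u),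
            (if u - Δ < pairFlightStart σ N Φ z p.1 p.2 u then (1 : ℝ) else 0) :=
        (Finset.sum_biUnion hdisj).symm
  have e3 : (∑ u ∈ (Finset.range ⌊τ / Δ⌋₊).biUnion (fun k => (hfink k).toFinset),
          ∑ p ∈ contactPairs (Torus.geometry (Fin 3)) (hsDiameter σ N) (orbit σ N Φ z u),
            (if u - Δ < pairFlightStart σ N Φ z p.1 p.2 u then (1 : ℝ) else 0))
        ≤ ∑ u ∈ hfinτ.toFinset, ∑ p ∈ contactPairs (Torus.geometry (Fin 3)) (hsDiameter σ N) (orbit σ N Φ z u),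
            (if u - Δ < pairFlightStart σ N Φ z p.1 p.2 u then (1 : ℝ) else 0) :=
        Finset.sum_le_sum_of_subset_of_nonneg hsub fun u _ _ => hf0 u
  have e4 : collisionPairSum (Torus.geometry (Fin 3)) (hsDiameter σ N) (orbit σ N Φ z) (Set.Icc 0 τ)
          (fun s i j => if s - Δ < pairFlightStart σ N Φ z i j s then (1 : ℝ) else 0) =
        ∑ u ∈ hfinτ.toFinset, ∑ p ∈ contactPairs (Torus.geometry (Fin 3)) (hsDiameter σ N) (orbit σ N Φ z u),
            (if u - Δ < pairFlightStart σ N Φ z p.1 p.2 u then (1 : ℝ) else 0) :=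
    collisionPairSum_eq_finset_sum hfinτ
      (fun s i j => if s - Δ < pairFlightStart σ N Φ z i j s then (1 : ℝ) else 0)
  rw [e4]
  exact e1.trans (e2.le.trans e3)

/-! ### Geometry of would-be pairs on `𝕋³`: forward contact and swept tubes -/

/-- The separation vector of the pair `(i, j)` after a FORWARD free flight of duration `t` on `𝕋³`:
`sep = reprSym ((xᵢ − xⱼ) + proj (t (vᵢ − vⱼ)))`. [folklore] -/
theorem sepVec_freeFlight_fwd {N : ℕ} (w : Config N (Fin 3) T3) (t : ℝ) (i j : Fin N) :
    (Torus.geometry (Fin 3)).sepVec ((freeFlight (Torus.geometry (Fin 3)) t w i).1)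
        ((freeFlight (Torus.geometry (Fin 3)) t w j).1) =
      Torus.reprSym (((w i).1 - (w j).1) + Torus.proj (t • ((w i).2 - (w j).2))) := by
  simp only [freeFlight_apply, Torus.geometry_translate, Torus.geometry_sepVec]
  congr 1
  have hps : ∀ a b : V3, Torus.proj (a - b) = Torus.proj a - Torus.proj b := fun _ _ => rfl
  rw [smul_sub, hps]
  abel

/-- The minimal-image norm is continuous along a forward free flight. [folklore] -/
theorem continuous_norm_reprSym_add_proj_smul (p : T3) (u : V3) :
    Continuous fun t : ℝ => ‖Torus.reprSym (p + Torus.proj (t • u))‖ := by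
  have h1 : Continuous fun t : ℝ => (p + Torus.proj (t • u), (0 : T3)) :=
    (continuous_const.add (Torus.continuous_proj.comp (continuous_id.smul continuous_const))).prodMk
      continuous_const
  have h2 := continuous_euclidDist_prod.comp h1
  refine h2.congr fun t => ?_
  simp only [Function.comp_apply, Torus.euclidDist_eq, sub_zero]

/-- **Would-be ⟹ contact.**  If `w` does not overlap at diameter `ε` and the free flights of `i ≠ j` come
within `ε` at some time of `(0, Δ]`, then they are at EXACT contact at some time of `[0, Δ]` (intermediate
value theorem for the continuous minimal-image distance, which is `≥ ε` at time `0`). [folklore] -/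
theorem exists_contact_of_wouldBe {N : ℕ} {ε Δ : ℝ} {w : Config N (Fin 3) T3}
    (hw : w ∈ hardSphereDomain (Torus.geometry (Fin 3)) N ε) {i j : Fin N} (hij : i ≠ j)
    (h : ∃ u ∈ Set.Ioc 0 Δ, ‖(Torus.geometry (Fin 3)).sepVec (freeFlight (Torus.geometry (Fin 3)) u w i).1
        (freeFlight (Torus.geometry (Fin 3)) u w j).1‖ ≤ ε) :
    ∃ s ∈ Set.Icc 0 Δ, ‖Torus.reprSym (((w i).1 - (w j).1) + Torus.proj (s • ((w i).2 - (w j).2)))‖ = ε := by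
  obtain ⟨u, hu, hle⟩ := h
  rw [sepVec_freeFlight_fwd] at hle
  have hf : Continuous fun t : ℝ =>
      ‖Torus.reprSym (((w i).1 - (w j).1) + Torus.proj (t • ((w i).2 - (w j).2)))‖ :=
    continuous_norm_reprSym_add_proj_smul _ _
  have h0 : ε ≤ ‖Torus.reprSym (((w i).1 - (w j).1) + Torus.proj ((0 : ℝ) • ((w i).2 - (w j).2)))‖ := by
    rw [zero_smul, Torus.proj_zero, add_zero]
    exact hw i j hij
  obtain ⟨s, hs, hfs⟩ := intermediate_value_Icc' hu.1.le hf.continuousOn ⟨hle, h0⟩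
  exact ⟨s, ⟨hs.1, hs.2.trans hu.2⟩, hfs⟩

/-- **Would-be ⟹ a lift of the relative position lies in the forward swept tube.**  For a family `S` with
the covering property of a swept tube of window `Δ` (`exists_sweptTube`): if the free flights of `i ≠ j`
issued from the non-overlapping `w` come within `ε` during `(0, Δ]`, then
`reprSym (xᵢ − xⱼ) + k ∈ S (vᵢ − vⱼ)` for some `k ∈ ℤ³`. [folklore] -/
theorem exists_latticeVec_mem_of_wouldBe {N : ℕ} {ε Δ : ℝ} {S : V3 → Set V3}
    (hS : ∀ (u r : V3) (s : ℝ), ε ≤ ‖r‖ → s ∈ Set.Icc 0 Δ → ‖r + s • u‖ = ε → r ∈ S u)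
    {w : Config N (Fin 3) T3} (hw : w ∈ hardSphereDomain (Torus.geometry (Fin 3)) N ε)
    {i j : Fin N} (hij : i ≠ j)
    (h : ∃ u ∈ Set.Ioc 0 Δ, ‖(Torus.geometry (Fin 3)).sepVec (freeFlight (Torus.geometry (Fin 3)) u w i).1
        (freeFlight (Torus.geometry (Fin 3)) u w j).1‖ ≤ ε) :
    ∃ k : Fin 3 → ℤ, Torus.reprSym ((w i).1 - (w j).1) + Torus.latticeVec k ∈ S ((w i).2 - (w j).2) := by
  obtain ⟨s, hs, hc⟩ := exists_contact_of_wouldBe hw hij h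
  have h2 : Torus.proj (Torus.reprSym ((w i).1 - (w j).1) + s • ((w i).2 - (w j).2)) =
      Torus.proj (Torus.reprSym (((w i).1 - (w j).1) + Torus.proj (s • ((w i).2 - (w j).2)))) := by
    rw [Torus.proj_reprSym, Torus.proj_add, Torus.proj_reprSym]
  obtain ⟨k, hk⟩ := (Torus.proj_eq_proj_iff_holds _ _).1 h2
  refine ⟨k, hS ((w i).2 - (w j).2) (Torus.reprSym ((w i).1 - (w j).1) + Torus.latticeVec k) s ?_ hs ?_⟩
  · exact (hw i j hij).trans (norm_reprSym_le_norm_add_latticeVec _ k)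
  · have : Torus.reprSym ((w i).1 - (w j).1) + Torus.latticeVec k + s • ((w i).2 - (w j).2) =
        Torus.reprSym ((w i).1 - (w j).1) + s • ((w i).2 - (w j).2) + Torus.latticeVec k := by abel
    rw [this, ← hk, hc]

/-- The would-be relation is symmetric (the minimal-image distance is). [folklore] -/
theorem mem_wouldBePairs_symm {n : ℕ} (ε Δ : ℝ) (z : Config n (Fin 3) T3) (i j : Fin n) :
    (i, j) ∈ wouldBePairs ε Δ z ↔ (j, i) ∈ wouldBePairs ε Δ z := by
  simp only [wouldBePairs, Finset.mem_filter, Finset.mem_univ, true_and]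
  have hsym : ∀ u : ℝ, ‖(Torus.geometry (Fin 3)).sepVec (freeFlight (Torus.geometry (Fin 3)) u z i).1
        (freeFlight (Torus.geometry (Fin 3)) u z j).1‖ =
      ‖(Torus.geometry (Fin 3)).sepVec (freeFlight (Torus.geometry (Fin 3)) u z j).1
        (freeFlight (Torus.geometry (Fin 3)) u z i).1‖ := fun u => by
    rw [Torus.norm_geometry_sepVec, Torus.norm_geometry_sepVec, Torus.euclidDist_comm]
  simp only [hsym, ne_comm]

/-- Membership in `wouldBePairs`, unfolded. [folklore] -/
theorem mem_wouldBePairs_iff {n : ℕ} (ε Δ : ℝ) (z : Config n (Fin 3) T3) (p : Fin n × Fin n) :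
    p ∈ wouldBePairs ε Δ z ↔ p.1 ≠ p.2 ∧
      ∃ u ∈ Set.Ioc 0 Δ, ‖(Torus.geometry (Fin 3)).sepVec
        (freeFlight (Torus.geometry (Fin 3)) u z p.1).1 (freeFlight (Torus.geometry (Fin 3)) u z p.2).1‖ ≤ ε := by
  simp only [wouldBePairs, Finset.mem_filter, Finset.mem_univ, true_and]

/-! ### Combinatorics: bursts are carried by would-be TRIPLES -/

/-- **Every multi-pair sits in a would-be triple.**  If `p = (i, j) ∈ multiPairs`, then `(i, j)` is would-be and
there is a third label `k ∉ {i, j}` with `(i, k)` or `(j, k)` would-be. [folklore] -/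
theorem exists_third_of_mem_multiPairs {n : ℕ} {ε Δ : ℝ} {z : Config n (Fin 3) T3} {p : Fin n × Fin n}
    (hp : p ∈ multiPairs ε Δ z) :
    p ∈ wouldBePairs ε Δ z ∧ ∃ k : Fin n, k ≠ p.1 ∧ k ≠ p.2 ∧
      ((p.1, k) ∈ wouldBePairs ε Δ z ∨ (p.2, k) ∈ wouldBePairs ε Δ z) := by
  simp only [multiPairs, Finset.mem_filter] at hp
  obtain ⟨hpW, hdeg⟩ := hp
  refine ⟨hpW, ?_⟩
  have hoff : ∀ q ∈ wouldBePairs ε Δ z, q.1 ≠ q.2 := fun q hq => ((mem_wouldBePairs_iff ε Δ z q).1 hq).1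
  rcases hdeg with h1 | h2
  · obtain ⟨a, ha, b, hb, hab⟩ := Finset.one_lt_card.1
      (show 1 < ((wouldBePairs ε Δ z).filter fun q => q.1 = p.1).card by omega)
    -- one of `a`, `b` differs from `p`
    obtain ⟨q, hq, hqp⟩ : ∃ q ∈ (wouldBePairs ε Δ z).filter (fun q => q.1 = p.1), q ≠ p := by
      by_cases hap : a = p
      · exact ⟨b, hb, fun h => hab (hap.trans h.symm)⟩
      · exact ⟨a, ha, hap⟩
    rw [Finset.mem_filter] at hq
    refine ⟨q.2, ?_, ?_, Or.inl ?_⟩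
    · rw [← hq.2]; exact (hoff q hq.1).symm
    · intro h
      exact hqp (Prod.ext hq.2 h)
    · rw [← hq.2]; exact hq.1
  · obtain ⟨a, ha, b, hb, hab⟩ := Finset.one_lt_card.1
      (show 1 < ((wouldBePairs ε Δ z).filter fun q => q.1 = p.2).card by omega)
    rw [Finset.mem_filter] at ha hb
    have hab2 : a.2 ≠ b.2 := fun h => hab (Prod.ext (ha.2.trans hb.2.symm) h)
    obtain ⟨q, hqW, hq1, hq2⟩ : ∃ q ∈ wouldBePairs ε Δ z, q.1 = p.2 ∧ q.2 ≠ p.1 := by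
      by_cases hap : a.2 = p.1
      · exact ⟨b, hb.1, hb.2, fun h => hab2 (hap.trans h.symm)⟩
      · exact ⟨a, ha.1, ha.2, hap⟩
    refine ⟨q.2, hq2, ?_, Or.inr ?_⟩
    · rw [← hq1]; exact (hoff q hqW).symm
    · rw [← hq1]; exact hqW

/-- **The burst count is dominated by the would-be triple counts** (types I: `(i,j),(i,k)` would-be; II:
`(i,j),(j,k)` would-be; `i, j, k` pairwise distinct). [folklore] -/
theorem card_multiPairs_le_sum {n : ℕ} (ε Δ : ℝ) (z : Config n (Fin 3) T3) :
    (multiPairs ε Δ z).card ≤ ∑ i : Fin n, ∑ j : Fin n, ∑ k : Fin n,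
      ((if i ≠ j ∧ i ≠ k ∧ j ≠ k ∧ (i, j) ∈ wouldBePairs ε Δ z ∧ (i, k) ∈ wouldBePairs ε Δ z then 1 else 0) +
        (if i ≠ j ∧ i ≠ k ∧ j ≠ k ∧ (i, j) ∈ wouldBePairs ε Δ z ∧ (j, k) ∈ wouldBePairs ε Δ z then 1 else 0)) := by
  classical
  set W := wouldBePairs ε Δ z with hW
  set f : Fin n × Fin n → Fin n → ℕ := fun p k =>
    (if p.1 ≠ p.2 ∧ p.1 ≠ k ∧ p.2 ≠ k ∧ (p.1, p.2) ∈ W ∧ (p.1, k) ∈ W then 1 else 0) +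
      (if p.1 ≠ p.2 ∧ p.1 ≠ k ∧ p.2 ≠ k ∧ (p.1, p.2) ∈ W ∧ (p.2, k) ∈ W then 1 else 0) with hf
  have hstep : ∀ p ∈ multiPairs ε Δ z, 1 ≤ ∑ k : Fin n, f p k := by
    intro p hp
    obtain ⟨hpW, k, hk1, hk2, hk⟩ := exists_third_of_mem_multiPairs hp
    have hij : p.1 ≠ p.2 := ((mem_wouldBePairs_iff ε Δ z p).1 hpW).1
    have hpW' : (p.1, p.2) ∈ W := hpW
    refine le_trans ?_ (Finset.single_le_sum (fun k _ => Nat.zero_le (f p k)) (Finset.mem_univ k))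
    rcases hk with h | h
    · have : (if p.1 ≠ p.2 ∧ p.1 ≠ k ∧ p.2 ≠ k ∧ (p.1, p.2) ∈ W ∧ (p.1, k) ∈ W then 1 else 0) = 1 :=
        if_pos ⟨hij, hk1.symm, hk2.symm, hpW', h⟩
      simp only [hf, this]
      omega
    · have : (if p.1 ≠ p.2 ∧ p.1 ≠ k ∧ p.2 ≠ k ∧ (p.1, p.2) ∈ W ∧ (p.2, k) ∈ W then 1 else 0) = 1 :=
        if_pos ⟨hij, hk1.symm, hk2.symm, hpW', h⟩
      simp only [hf, this]
      omega
  calc (multiPairs ε Δ z).card = ∑ p ∈ multiPairs ε Δ z, 1 := by simp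
    _ ≤ ∑ p ∈ multiPairs ε Δ z, ∑ k : Fin n, f p k := Finset.sum_le_sum hstep
    _ ≤ ∑ p ∈ (Finset.univ : Finset (Fin n × Fin n)), ∑ k : Fin n, f p k :=
        Finset.sum_le_sum_of_subset_of_nonneg (Finset.subset_univ _) fun p _ _ => Nat.zero_le _
    _ = ∑ i : Fin n, ∑ j : Fin n, ∑ k : Fin n, f (i, j) k := by
        rw [← Finset.univ_product_univ, Finset.sum_product]

/-! ### Asymptotics of the window: `Δ_N → 0` and `Δ_N (N+1) ε_N² → 0` for `b > 1/3` -/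

/-- `Δ_N · (N+1) ε_N² = A σ² (N+1)^{1/3 − b}`. [folklore] -/
theorem windowLenB_mul_succ_mul_sq (A b σ : ℝ) (N : ℕ) :
    windowLenB A b N * (((N + 1 : ℕ) : ℝ) * hsDiameter σ N ^ 2) =
      A * σ ^ 2 * ((N + 1 : ℕ) : ℝ) ^ (1 / 3 - b) := by
  have hn : (0 : ℝ) < ((N + 1 : ℕ) : ℝ) := by positivity
  rw [windowLenB, hsDiameter, mul_pow, ← Real.rpow_natCast (((N + 1 : ℕ) : ℝ) ^ (-(1 / 3 : ℝ))) 2,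
    ← Real.rpow_mul hn.le]
  have h : ((N + 1 : ℕ) : ℝ) ^ (1 / 3 - b) =
      ((N + 1 : ℕ) : ℝ) ^ (-b) * (((N + 1 : ℕ) : ℝ) ^ (1 : ℝ) * ((N + 1 : ℕ) : ℝ) ^ (-(1 / 3 : ℝ) * ((2 : ℕ) : ℝ))) := by
    rw [← Real.rpow_add hn, ← Real.rpow_add hn]
    congr 1
    push_cast
    ring
  rw [h, Real.rpow_one]
  ring

/-- `Δ_N → 0` (`b > 0`). [folklore] -/
theorem tendsto_windowLenB (A : ℝ) {b : ℝ} (hb : 0 < b) :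
    Tendsto (fun N : ℕ => windowLenB A b N) atTop (𝓝 0) := by
  have h1 : Tendsto (fun N : ℕ => ((N + 1 : ℕ) : ℝ)) atTop atTop :=
    tendsto_natCast_atTop_atTop.comp (tendsto_add_atTop_nat 1)
  have h2 := ((tendsto_rpow_neg_atTop hb).comp h1).const_mul A
  rw [mul_zero] at h2
  refine h2.congr fun N => ?_
  simp only [windowLenB, Function.comp_apply]

/-- `Δ_N (N+1) ε_N² → 0` (`b > 1/3`). [folklore] -/
theorem tendsto_windowLenB_mul (A σ : ℝ) {b : ℝ} (hb : 1 / 3 < b) :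
    Tendsto (fun N : ℕ => windowLenB A b N * (((N + 1 : ℕ) : ℝ) * hsDiameter σ N ^ 2)) atTop (𝓝 0) := by
  have h1 : Tendsto (fun N : ℕ => ((N + 1 : ℕ) : ℝ)) atTop atTop :=
    tendsto_natCast_atTop_atTop.comp (tendsto_add_atTop_nat 1)
  have h2 := ((tendsto_rpow_neg_atTop (by linarith : 0 < b - 1 / 3)).comp h1).const_mul (A * σ ^ 2)
  rw [mul_zero] at h2
  refine h2.congr fun N => ?_
  rw [windowLenB_mul_succ_mul_sq, Function.comp_apply]
  congr 1
  ring_nf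

/-- The algebra of the rung-0 bound: with `n ε³ = σ³` and `y = η n/(2ε)`, the static bound (with `⌊τ/Δ⌋`
replaced by `τ/Δ`) plus the short-flight bound equals `C₁ Δ + C₂ · Δ n ε²`. [folklore] -/
theorem rung0_bound_algebra (τ η m σ n ε Δ : ℝ) (hη : η ≠ 0) (hn : n ≠ 0) (hε : ε ≠ 0) (hΔ : Δ ≠ 0)
    (hσ3 : n * ε ^ 3 = σ ^ 3) :
    (τ / Δ) * n ^ 3 * (2048 * ε ^ 4 * Δ ^ 2 * m) / (η * n / (2 * ε)) +
        (1 + 4 * m) * Δ * (48 * n ^ 2 * ε ^ 2 + 192 * τ * n ^ 2 * ε ^ 2 + 1536 * τ * n ^ 3 * ε ^ 4) /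
          (η * n / (2 * ε)) =
      (2 * (1 + 4 * m) / η * (48 * σ ^ 3 + 192 * τ * σ ^ 3)) * Δ +
        (2 * (1 + 4 * m) / η * (1536 * τ * σ ^ 3) + 4096 * τ * m * σ ^ 3 / η) * (Δ * (n * ε ^ 2)) := by
  rw [← hσ3]
  field_simp
  ring


/-! ### Registered helper stub -/

/-- **Helper stub `stub_secondaryLeShortFlight`** (registered on stmt-AtomisticToContinuum-13080 for this file): `∀`-form of
`sum_secondaryCount_le_shortCount` — on a good orbit the window-summed secondary incidences are at most the short-flight count with
flight window `Δ`. [folklore] -/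
theorem stub_secondaryLeShortFlight :
    ∀ (σ : ℝ) (N : ℕ) (Φ : HardSphereFlow (Torus.geometry (Fin 3)) (hsDiameter σ N) (N + 1)) (z : Config (N + 1) (Fin 3) T3), z ∈ Φ.good → ∀ (Δ τ : ℝ), 0 < Δ → 0 ≤ τ → (∑ k ∈ Finset.range ⌊τ / Δ⌋₊, (secondaryCount (hsDiameter σ N) (orbit σ N Φ z) (k * Δ) (k * Δ + Δ) : ℝ)) ≤ collisionPairSum (Torus.geometry (Fin 3)) (hsDiameter σ N) (orbit σ N Φ z) (Set.Icc 0 τ) (fun s i j => if s - Δ < pairFlightStart σ N Φ z i j s then (1 : ℝ) else 0) :=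
  fun _ _ Φ _ hz _ _ hΔ hτ => sum_secondaryCount_le_shortCount Φ hz hΔ hτ

end RateFloorNoBursts

end Summit.AtomisticToContinuum.HydrodynamicLimit.Theorems

end
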